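import Summits.Parity.GeneralizedHardyLittlewood.Theorems.LeeYangFibresCellsToRelativeDimOneCounts
import HarnessLib

/-!
# Tools for `PrimeCellsRelative ⟹ Dickson / Hardy–Littlewood` (crux stmt-Parity-14112, line `Sketch`)

Route-file-free lemmas used by the hardness certificates
`Theorems/LeeYangFibresPrimeCellsRelativeDickson.lean` (the crux `PrimeCellsRelative` of route
`LeeYangFibres`, Parity / GeneralizedHardyLittlewood, implies Dickson's conjecture parity.S07):

* `exists_prime_dvd_forall_of_proportional` — two distinct proportional forms `aᵢ n + bᵢ`,
  `aⱼ n + bⱼ` (`aᵢ, aⱼ ≥ 1`) have a fixed prime divisor (so admissible families are non-degenerate);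
* `one_le_two_mul_log_mul_roughDensity` — inside the prime number theorem window, the rough prime
  count `A₁(N) = #{m ≤ N : P⁻(m) > N^{1/u}, Ω(m) = 1}` has `2 log N · A₁(N)/N ≥ 1`;
* `cell_pos_arith` — the real arithmetic turning the crux's relative + absolute asymptotic into
  positivity of the cell count once `β_∞ ≥ N`, `𝔖 > 0` and `ε ≤ min(1/2, 𝔖/2^{t+2})`.

References: B. Green, T. Tao, Ann. of Math. 171 (2010), Conj. 1.4 [GreenTao2010]; H. L. Montgomery,
R. C. Vaughan, *Multiplicative Number Theory I*, §8.1 [MontgomeryVaughan2007].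
-/

noncomputable section

namespace Summit.Parity.GeneralizedHardyLittlewood.Cruxes.PrimeCellsRelative.Sketch

open scoped BigOperators Topology Classical
open Filter Finset Literature.NumberTheory.Sieve
open Summit.Parity.GeneralizedHardyLittlewood.Theorems.LeeYangFibresCells

/-! ### Arithmetic of proportional forms -/

/-- If two forms `aᵢ n + bᵢ`, `aⱼ n + bⱼ` (`aᵢ, aⱼ ≥ 1`) with `(aᵢ, bᵢ) ≠ (aⱼ, bⱼ)` are proportional,
`A·(aᵢ, bᵢ) = B·(aⱼ, bⱼ)` with `A, B ≠ 0`, then one of them has a fixed prime divisor: writing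
`A/B = A'/B'` in lowest terms, `(A', B') = ±(1, 1)` would force the forms to coincide, so some prime
`p` divides `A'` (and not `B'`) or `B'` (and not `A'`), and then `p ∣ aⱼ n + bⱼ` resp. `p ∣ aᵢ n + bᵢ`
for every `n`. [folklore] -/
theorem exists_prime_dvd_forall_of_proportional {ai bi aj bj : ℕ} {A B : ℤ} (hA : A ≠ 0)
    (hB : B ≠ 0) (hai : 1 ≤ ai) (haj : 1 ≤ aj) (hne : (ai, bi) ≠ (aj, bj))
    (h1 : A * ai = B * aj) (h2 : A * bi = B * bj) :
    ∃ p : ℕ, p.Prime ∧ ((∀ n : ℕ, p ∣ aj * n + bj) ∨ (∀ n : ℕ, p ∣ ai * n + bi)) := by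
  have hg : 0 < Int.gcd A B := Int.gcd_pos_of_ne_zero_left _ hA
  obtain ⟨g, A', B', hg0, hcop, hAg, hBg⟩ := Int.exists_gcd_one' hg
  have hg0' : (g : ℤ) ≠ 0 := by exact_mod_cast hg0.ne'
  have hA' : A' ≠ 0 := by rintro rfl; simp at hAg; exact hA hAg
  have hB' : B' ≠ 0 := by rintro rfl; simp at hBg; exact hB hBg
  have h1' : A' * ai = B' * aj := by
    have : A' * ai * g = B' * aj * g := by
      calc A' * ai * g = A * ai := by rw [hAg]; ring
        _ = B * aj := h1
        _ = B' * aj * g := by rw [hBg]; ring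
    exact mul_right_cancel₀ hg0' this
  have h2' : A' * bi = B' * bj := by
    have : A' * bi * g = B' * bj * g := by
      calc A' * bi * g = A * bi := by rw [hAg]; ring
        _ = B * bj := h2
        _ = B' * bj * g := by rw [hBg]; ring
    exact mul_right_cancel₀ hg0' this
  -- the key divisibility step
  have key : ∀ {P : ℤ} {X Y : ℤ} {c d e f : ℕ}, Prime P → P ∣ X → ¬ P ∣ Y →
      X * c = Y * e → X * d = Y * f → ∀ n : ℕ, P.natAbs ∣ e * n + f := by
    intro P X Y c d e f hP hPX hPY hce hdf n
    have hid : Y * ((e * n + f : ℕ) : ℤ) = X * ((c * n + d : ℕ) : ℤ) := by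
      push_cast
      linear_combination (↑n : ℤ) * hce.symm + hdf.symm  -- Y*(e n + f) = X*(c n + d)
    have hdvd : P ∣ Y * ((e * n + f : ℕ) : ℤ) := hid ▸ dvd_mul_of_dvd_left hPX _
    rcases hP.dvd_or_dvd hdvd with h | h
    · exact absurd h hPY
    · rwa [← Int.natAbs_dvd, Int.natCast_dvd_natCast] at h
  by_cases hunits : A'.natAbs = 1 ∧ B'.natAbs = 1
  · -- `A' = ±1`, `B' = ±1` with the same sign: the forms coincide
    exfalso
    obtain ⟨hA1, hB1⟩ := hunits
    have hai0 : (0 : ℤ) < ai := by exact_mod_cast hai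
    have haj0 : (0 : ℤ) < aj := by exact_mod_cast haj
    rcases Int.natAbs_eq_natAbs_iff.mp (hA1.trans hB1.symm) with hAB | hAB
    · rw [hAB] at h1' h2'
      have e1 : (ai : ℤ) = aj := mul_left_cancel₀ hB' h1'
      have e2 : (bi : ℤ) = bj := mul_left_cancel₀ hB' h2'
      exact hne (by rw [Prod.mk.injEq]; exact ⟨by exact_mod_cast e1, by exact_mod_cast e2⟩)
    · rw [hAB] at h1'
      have : -B' * ai ≤ 0 ∨ 0 ≤ -B' * ai := le_total _ _
      rcases Int.natAbs_eq B' with hb | hb <;> rw [hB1] at hb <;> norm_num at hb <;>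
        rw [hb] at h1' <;> push_cast at h1' <;> nlinarith
  · rw [not_and_or] at hunits
    rcases hunits with hA1 | hB1
    · obtain ⟨P, hP, hPA⟩ := Int.exists_prime_and_dvd hA1
      have hPB : ¬ P ∣ B' := fun hPB => hP.not_unit
        (isUnit_of_dvd_one (by
          have := Int.dvd_coe_gcd hPA hPB
          rwa [hcop, Nat.cast_one] at this))
      refine ⟨P.natAbs, Int.prime_iff_natAbs_prime.mp hP, Or.inl ?_⟩
      exact key hP hPA hPB h1' h2'
    · obtain ⟨P, hP, hPB⟩ := Int.exists_prime_and_dvd hB1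
      have hPA : ¬ P ∣ A' := fun hPA => hP.not_unit
        (isUnit_of_dvd_one (by
          have := Int.dvd_coe_gcd hPA hPB
          rwa [hcop, Nat.cast_one] at this))
      refine ⟨P.natAbs, Int.prime_iff_natAbs_prime.mp hP, Or.inr ?_⟩
      exact key hP hPB hPA h1'.symm h2'.symm

/-! ### The rough prime count in the prime number theorem window -/

/-- **Prime number theorem for the rough prime count**: inside the PNT window
(`eventually_primeCounting_window` at `η = 1/2`), for `u ≥ 2` the rough prime count
`A₁(N) = #{m ≤ N : P⁻(m) > N^{1/u}, Ω(m) = 1} ∈ [π(N) − √N, π(N)]` has `2 log N · A₁(N)/N ≥ 1`. The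
decidability instance of the filter is an implicit ARGUMENT so that the lemma applies verbatim to the
finset printed in the route file. [cite: MontgomeryVaughan2007, §8.1 eq. (8.1)] -/
theorem one_le_two_mul_log_mul_roughDensity {N u : ℕ}
    {hdec : DecidablePred fun m : ℕ => (N : ℝ) ^ ((1 : ℝ) / u) < (Nat.minFac m : ℝ) ∧
      ArithmeticFunction.cardFactors m = 1}
    (hwin : ∀ A : ℝ, (Nat.primeCounting N : ℝ) - Real.sqrt N ≤ A → A ≤ Nat.primeCounting N →
      (1 - 1 / 2) * N ≤ A * Real.log N ∧ A * Real.log N ≤ (1 + 1 / 2) * N)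
    (hN : 1 ≤ N) (hu : 2 ≤ u) :
    1 ≤ 2 * Real.log N * ((#((Icc 1 N).filter fun m => (N : ℝ) ^ ((1 : ℝ) / u) < (Nat.minFac m : ℝ) ∧
        ArithmeticFunction.cardFactors m = 1) : ℝ) / N) := by
  have hZ0 : 0 ≤ (N : ℝ) ^ ((1 : ℝ) / u) := Real.rpow_nonneg (Nat.cast_nonneg N) _
  have hN1' : (1 : ℝ) ≤ N := by exact_mod_cast hN
  have hN0 : (0 : ℝ) < N := by linarith
  have hZle : (N : ℝ) ^ ((1 : ℝ) / u) ≤ Real.sqrt N := by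
    rw [Real.sqrt_eq_rpow]
    refine Real.rpow_le_rpow_of_exponent_le hN1' ?_
    have : (2 : ℝ) ≤ u := by exact_mod_cast hu
    rw [one_div_le (by positivity) (by norm_num), one_div_one_div]
    exact this
  have hlo := primeCounting_le_card_roughPrimes_add N hZ0 (hdec := hdec)
  have hhi := card_roughPrimes_le_primeCounting N ((N : ℝ) ^ ((1 : ℝ) / u)) (hdec := hdec)
  have h := (hwin _ (by linarith) hhi).1
  rw [mul_comm (2 * Real.log N), div_mul_eq_mul_div, le_div_iff₀ hN0]
  linarith

/-! ### Real arithmetic of the cell lower bound -/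

/-- **Real arithmetic of the cell lower bound.** From the crux's asymptotic
`|C − β S r^t| ≤ ε (β S r^t + N/log^t N)` with `β ≥ N ≥ 2`, `S > 0`, `2 r log N ≥ 1`, `ε ≤ 1/2` and
`ε ≤ S/2^{t+2}`: the main term is `≥ S (N/log^t N)/2^t`, so `C ≥ S (N/log^t N)/2^{t+2} > 0`. [folklore] -/
theorem cell_pos_arith (t : ℕ) {C β S r ε N : ℝ}
    (hb : |C - β * S * r ^ t| ≤ ε * (β * S * r ^ t + N / Real.log N ^ t))
    (hN : 2 ≤ N) (hβ : N ≤ β) (hS : 0 < S) (hr : 1 ≤ 2 * Real.log N * r)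
    (hε1 : ε ≤ 1 / 2) (hε2 : ε ≤ S / 2 ^ (t + 2)) : 0 < C := by
  have hlog : 0 < Real.log N := Real.log_pos (by linarith)
  have hN0 : 0 < N := by linarith
  set P : ℝ := 2 ^ t with hP
  have hP0 : 0 < P := by positivity
  have hl2 : 0 < 2 * Real.log N := by linarith
  set X : ℝ := N / Real.log N ^ t with hX
  have hX0 : 0 < X := div_pos hN0 (pow_pos hlog t)
  set M : ℝ := β * S * r ^ t with hM
  -- `r ≥ 1/(2 log N)`, so `M ≥ N S / (2 log N)^t = S X / P`
  have hq0 : 0 < 1 / (2 * Real.log N) := div_pos one_pos hl2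
  have hr' : 1 / (2 * Real.log N) ≤ r := by
    rw [div_le_iff₀ hl2]; linarith
  have hr0 : 0 ≤ r := le_trans hq0.le hr'
  set Y : ℝ := S * X / P with hY
  have hY0 : 0 < Y := div_pos (mul_pos hS hX0) hP0
  have hYM : Y ≤ M := by
    have h1 : (1 / (2 * Real.log N)) ^ t ≤ r ^ t := pow_le_pow_left₀ hq0.le hr' t
    have h2 : N * S * (1 / (2 * Real.log N)) ^ t ≤ β * S * r ^ t :=
      mul_le_mul (mul_le_mul_of_nonneg_right hβ hS.le) h1 (pow_nonneg hq0.le t)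
        (mul_nonneg (le_trans hN0.le hβ) hS.le)
    have h3 : N * S * (1 / (2 * Real.log N)) ^ t = Y := by
      rw [hY, hX, hP, div_pow, mul_pow, one_pow]
      field_simp
    linarith
  have hM0 : 0 ≤ M := le_trans hY0.le hYM
  have hεM : ε * M ≤ M / 2 := by nlinarith
  have hεX : ε * X ≤ Y / 4 := by
    have h1 : ε * X ≤ S / 2 ^ (t + 2) * X := mul_le_mul_of_nonneg_right hε2 hX0.le
    have h2 : S / 2 ^ (t + 2) * X = Y / 4 := by
      rw [hY, hP, pow_add]; field_simp; ring
    linarith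
  have hlow := (abs_le.mp hb).1
  rw [mul_add] at hlow
  linarith

end Summit.Parity.GeneralizedHardyLittlewood.Cruxes.PrimeCellsRelative.Sketch

end
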